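import Summits.BirchSwinnertonDyer.BirchSwinnertonDyer.Theorems.ByReductionTypeAtTwoRankOneAtTwoBigImageOddLocalOneDoorSubslicePosDisc
import Summits.BirchSwinnertonDyer.BirchSwinnertonDyer.Theorems.ByReductionTypeAtTwoRankOneAtTwoBigImageOddLocalOneDoorPairParity
import Summits.BirchSwinnertonDyer.Rank1Residual.F1Sign2.DoorVisibilityAtTwo
import Literature.NumberTheory.EllipticCurves.BSDQuadraticDescentShaOddPartGeneralProofs
import HarnessLib

/-!
# Route ByReductionTypeAtTwo, crux `RankOneAtTwoBigImageOddLocal` (stmt-BirchSwinnertonDyer-23715), LINE v8.17 `one_door_analytic`, residue R_S: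
# -desc's «Ш[2] IN THE DOOR» TRANSPORT in door currency — on the egg residue {`Δ_W > 0`, `Ш(W)[2] ≅ (ℤ/2)²`, `MeetsEgg`} every lawful archimedean
# door datum has Heegner exponent `m ≥ 2 + v₂(c)`

Width prover seat `bsd-line-fkl-p2` g14 (2026-08-28), `--supports stmt-BirchSwinnertonDyer-23715` (helper).  THEOREMS ONLY; BSD is not proved by any of
this.  The cell's descent lens (-desc g19, MEMO-desc §27; typer filing `F1Sign2/DoorVisibilityAtTwo.lean`) proved, hypothesis-free, the TRANSPORT row X
`residueDoorShaTwoTransportCardAtTwo_holds`: for `W` on the residue `OnResidueAtTwo W` (`Δ_W > 0`, `E(ℚ)[2] = 0`, rank `1`, `#Ш(W)[2] = 4`, `MeetsEgg`) and a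
desc-admissible `d` with `rank W^{(d)}(ℚ) = 0`, `#Ш(W^{(d)})[2] = 4`.  This file reads it in the door currency of the v8.17 residue R_S
(`DoorIndexLawFullCAtTwoSomeDoorResidueSha` = `LawfulDoorOfShaTwoNontrivialAtTwo`): at a NON-VANISHING desc-admissible door datum of such a curve (the twin has
rank `0` by Gross–Zagier + Kolyvagin over `K`, `mordellWeilRank_twin_eq_zero`), both `2`-primary orders are divisible by `4` (`s_W ≥ 2`, `s_d ≥ 2`,
`four_dvd_natCard_primaryComponent_of_shaTwoCard_eq_four`, `card_primaryComponent_sha_variableChange`), the door is minimal (`t = s = 0`), so the lawful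
identity `2m = s_W + s_d + 2·v₂(c)` forces **`m ≥ 2 + v₂(c)`**: the Heegner point of any lawful archimedean datum lies in `4·2^{v₂(c)}·E(K) + E(K)_tors`.  Under
`BSDp W 2` (per-datum kernel iff) the same bound holds at EVERY non-vanishing desc-admissible door datum — a falsifiable prediction matching -desc's census
(kit j317979: `4 ∣ Ш_an(W^d)` at 3 746/3 746 rank-0 archimedean doors of residue egg curves).

* `two_le_padicValNat_of_four_dvd`; `two_le_sW_of_shaTwoCard_eq_four` (`s_W ≥ 2`) and `two_le_sd_of_residue` (`s_d ≥ 2` on any model of the twin);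
* **`exponent_ge_two_add_padicVal_of_lawful_at_residue`** (lawful archimedean datum ⟹ `2 + v₂(c) ≤ m`);
* **`exponent_ge_two_add_padicVal_of_bsdp_two_at_residue`** (`BSDp W 2` + print + rank-`0` `BSD₂` ⟹ the same at every non-vanishing desc-admissible datum).

References: [Kramer1981] §2 Prop. 6, Thm. 1; [MazurRubin2010] Prop. 3.3, Cor. 3.4 (i); [GrossLMS1991] §§2–3, §10; [SilvermanAEC2009] Thm. X.4.2.
-/

set_option autoImplicit false
-- the Theorems namespace of this sub repeats the summit name by design (D-0017 nested layout)
set_option linter.dupNamespace false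

noncomputable section

open scoped Classical

namespace Summit.BirchSwinnertonDyer.BirchSwinnertonDyer.Theorems.RankOneAtTwoOneDoor

open WeierstrassCurve NumberField Literature.NumberTheory.EllipticCurves Literature.NumberTheory.EllipticCurves.ModularForms
  Summit.BirchSwinnertonDyer.Rank1Residual.F1Sign2
  Summit.BirchSwinnertonDyer.Rank1Residual.F1Sign2.TranspositionDoor
  Summit.BirchSwinnertonDyer.BirchSwinnertonDyer.Theses.ByReductionTypeAtTwo

/-- `4 ∣ n`, `n ≠ 0` ⟹ `2 ≤ v₂(n)`. [folklore] -/
theorem two_le_padicValNat_of_four_dvd {n : ℕ} (hn : n ≠ 0) (h4 : 4 ∣ n) : 2 ≤ padicValNat 2 n :=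
  (padicValNat_dvd_iff_le hn).mp (by norm_num; exact h4)

/-- **`s_W ≥ 2` on the residue**: `#Ш(W)[2] = 4` and `Ш(W)[2^∞]` finite ⟹ `4 ∣ #Ш(W)[2^∞]` ⟹ `2 ≤ ord₂ #Ш(W)[2^∞]`. [cite: SilvermanAEC2009, Thm. X.4.2] -/
theorem two_le_sW_of_shaTwoCard_eq_four (W : WeierstrassCurve ℚ) [Finite (AddCommGroup.primaryComponent W.sha 2)] (h : shaTwoCard W = 4) :
    2 ≤ padicValNat 2 (Nat.card (AddCommGroup.primaryComponent W.sha 2)) :=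
  two_le_padicValNat_of_four_dvd (Nat.card_pos.ne') (four_dvd_natCard_primaryComponent_of_shaTwoCard_eq_four W h)

/-- **`s_d ≥ 2` on the residue at a rank-`0` archimedean door, on ANY model of the twin** (-desc's transport row X + `Ш` is attached to the curve,
`card_primaryComponent_sha_variableChange`). [cite: Kramer1981, §2 Prop. 6] [cite: MazurRubin2010, Cor. 3.4 (i)] [cite: SilvermanAEC2009, X.§4] -/
theorem two_le_sd_of_residue (W : WeierstrassCurve ℚ) [W.IsElliptic] [W.IsGloballyMinimal] (hres : OnResidueAtTwo W) {d : ℤ}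
    (hd : DescAdmissible W d) (hr0 : (W.quadraticTwist (d : ℚ)).mordellWeilRank = 0)
    (Wd : WeierstrassCurve ℚ) (Cd : VariableChange ℚ) (hWd : Cd • W.quadraticTwist (d : ℚ) = Wd)
    [Finite (AddCommGroup.primaryComponent Wd.sha 2)] :
    2 ≤ padicValNat 2 (Nat.card (AddCommGroup.primaryComponent Wd.sha 2)) := by
  have h4 : shaTwoCard (W.quadraticTwist (d : ℚ)) = 4 := residueDoorShaTwoTransportCardAtTwo_holds W hres d hd hr0
  have hcard : Nat.card (AddCommGroup.primaryComponent Wd.sha 2) = Nat.card (AddCommGroup.primaryComponent (W.quadraticTwist (d : ℚ)).sha 2) := by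
    rw [← hWd]; exact WeierstrassCurve.card_primaryComponent_sha_variableChange _ _ 2
  haveI : Finite (AddCommGroup.primaryComponent (W.quadraticTwist (d : ℚ)).sha 2) := by
    have e : Cd⁻¹ • Wd = W.quadraticTwist (d : ℚ) := by rw [← hWd, inv_smul_smul]
    rw [← e]
    exact WeierstrassCurve.finite_primaryComponent_sha_variableChange Wd Cd⁻¹ 2
  rw [hcard]
  exact two_le_padicValNat_of_four_dvd (Nat.card_pos.ne') (four_dvd_natCard_primaryComponent_of_shaTwoCard_eq_four _ h4)

/-- **ON THE EGG RESIDUE, A LAWFUL ARCHIMEDEAN DOOR DATUM HAS HEEGNER EXPONENT `m ≥ 2 + v₂(c)`.**  `W/ℚ` globally minimal with odd torsion order, analytic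
rank `1`, `rank E(ℚ) = 1`, on -desc's residue (`OnResidueAtTwo W`: `Δ_W > 0`, `E(ℚ)[2] = 0`, rank `1`, `#Ш(W)[2] = 4`, `MeetsEgg`); `K` imaginary quadratic with `d_K`
DESC-admissible and the door NON-VANISHING (`L(W^{(d_K)},1) ≠ 0`); Gross–Zagier and Kolyvagin at `(N_W, W, K)`, modularity (for `rank E(K) = 1`, hence
`rank W^{(d_K)}(ℚ) = 0`); any datum `Dt`, `H`, `ι`, `P` over the complex Heegner point; `Wd` a globally minimal model of the twist with `Ш(W)[2^∞]`, `Ш(Wd)[2^∞]`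
finite; and an exponent `m` satisfying the lawful identity at this datum.  THEN `2 + v₂(c) ≤ m`: the door is minimal (`t = s = 0`), `s_W ≥ 2`, `s_d ≥ 2`
(transport), and `2m = s_W + s_d + 2·v₂(c)`.  So on this population the residue R_S needs a Heegner point in `4·2^{v₂(c)}·E(K) + E(K)_tors` at every lawful
archimedean door.  CONDITIONAL by design (named printed facts as hypotheses); BSD is not proved by this. [cite: Kramer1981, §2 Prop. 6 and Thm. 1]
[cite: MazurRubin2010, Prop. 3.3 and Cor. 3.4 (i)] [cite: GrossLMS1991, §§2–3 and §10] -/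
theorem exponent_ge_two_add_padicVal_of_lawful_at_residue (hnf : exists_isNewformOf)
    (W : WeierstrassCurve ℚ) [W.IsElliptic] [W.IsGloballyMinimal] [NeZero (W.conductorNorm ℤ)]
    (hr : W.analyticRank = 1) (hrQ : W.mordellWeilRank = 1) (hres : OnResidueAtTwo W)
    (K : Type) [Field K] [NumberField K] (hK : IsImaginaryQuadratic K)
    (hGZ : gross_zagier (W.conductorNorm ℤ) W K) (hKo : kolyvagin (W.conductorNorm ℤ) W K)
    (hDA : DescAdmissible W (NumberField.discr K)) (hLt : (W.quadraticTwist (NumberField.discr K : ℚ)).entireLFunction 1 ≠ 0)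
    (Dt : ModularParametrizationData W (W.conductorNorm ℤ)) (H : HeegnerDatum (W.conductorNorm ℤ) (NumberField.discr K)) (ι : K →+* ℂ)
    (P : (W.baseChange K).toAffine.Point) (hP : WeierstrassCurve.Affine.Point.map ι.toRatAlgHom P = heegnerPointComplex Dt H)
    (Wd : WeierstrassCurve ℚ) [Wd.IsElliptic] (Cd : VariableChange ℚ) (hWd : Cd • W.quadraticTwist (NumberField.discr K : ℚ) = Wd)
    [Finite (AddCommGroup.primaryComponent W.sha 2)] [Finite (AddCommGroup.primaryComponent Wd.sha 2)]
    (m : ℕ)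
    (hlaw : 2 * m + (if W.Δ < 0 then 1 else 0) =
      padicValNat 2 (Nat.card (AddCommGroup.primaryComponent W.sha 2)) +
        padicValNat 2 (Nat.card (AddCommGroup.primaryComponent Wd.sha 2)) +
        transpCount W (NumberField.discr K) + 2 * identCount W (NumberField.discr K) + 2 * padicValInt 2 Dt.c) :
    2 + padicValInt 2 Dt.c ≤ m := by
  have hmod : hasEntireLFunction_rat := hasEntireLFunction_rat_of_exists_isNewformOf hnf
  have hres' := hres
  obtain ⟨hΔ, -, -, hsha4, -⟩ := hres'
  have hadm : DoorAdmissible W (NumberField.discr K) := ANg16.doorAdmissible_of_descAdmissible W hDA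
  -- the twin has rank `0`
  obtain ⟨hrkK, -, -, -⟩ := exists_unique_exponent_at_door hmod W hr K hK hGZ hKo hadm hLt Dt H ι P hP
  have hr0 : (W.quadraticTwist (NumberField.discr K : ℚ)).mordellWeilRank = 0 :=
    mordellWeilRank_twin_eq_zero W K hK.1 hrkK hrQ (W.quadraticTwist (NumberField.discr K : ℚ)) 1 (one_smul _ _)
  -- `s_W ≥ 2`, `s_d ≥ 2`, `t = s = 0`
  have hsW := two_le_sW_of_shaTwoCard_eq_four W hsha4
  have hsd := two_le_sd_of_residue W hres hDA hr0 Wd Cd hWd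
  rw [transpCount_eq_zero_of_descAdmissible W hDA, identCount_eq_zero_of_descAdmissible W hDA, if_neg (not_lt.mpr hΔ.le)] at hlaw
  omega

/-- **UNDER `BSDp W 2`, EVERY NON-VANISHING DESC-ADMISSIBLE DOOR DATUM OF AN EGG-RESIDUE CURVE HAS HEEGNER EXPONENT `m ≥ 2 + v₂(c)`** — the BSD-predicted,
falsifiable form (-desc's census: `4 ∣ Ш_an(W^d)` at 3 746/3 746 rank-`0` archimedean doors).  `W` of the slice's shape (odd torsion, odd Tamagawa product,
analytic rank `1`) on the residue, `BSDp W 2`, Gross–Zagier / Kolyvagin / modularity / Hoffstein–Luo as hypotheses, `BSDp Wd 2` for the globally minimal twin model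
(rank-`0` `BSD₂`), and the datum's exponent `m` (`HasTwoDivisibilityUpToTorsion W K P m`): the per-datum kernel iff `bsdp_two_iff_doorLawFullC_at_of_rank` gives a lawful
exponent, unique (`exists_unique_exponent_at_door`), and the previous theorem bounds it.  CONDITIONAL by design; BSD is not proved by this.
[cite: GrossZagier1986, Thm. I.6.3 and V.§2] [cite: Kramer1981, §2 Prop. 6] [cite: MazurRubin2010, Cor. 3.4 (i)] -/
theorem exponent_ge_two_add_padicVal_of_bsdp_two_at_residue
    (hGZ : ∀ (N : ℕ) [NeZero N] (W : WeierstrassCurve ℚ) (K : Type) [Field K] [NumberField K], gross_zagier N W K)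
    (hKo : ∀ (N : ℕ) [NeZero N] (W : WeierstrassCurve ℚ) (K : Type) [Field K] [NumberField K], kolyvagin N W K)
    (hnf : exists_isNewformOf) (hHL : HoffsteinLuo1997_exists_twist_L_one_ne_zero)
    (W : WeierstrassCurve ℚ) [W.IsElliptic] [W.IsGloballyMinimal] [NeZero (W.conductorNorm ℤ)]
    (hT : Odd W.torsionOrder) (hc : Odd W.tamagawaProduct) (hr : W.analyticRank = 1) (hres : OnResidueAtTwo W) (hB : BSDp W 2)
    (K : Type) [Field K] [NumberField K] (hK : IsImaginaryQuadratic K)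
    (hDA : DescAdmissible W (NumberField.discr K)) (hLt : (W.quadraticTwist (NumberField.discr K : ℚ)).entireLFunction 1 ≠ 0)
    (Dt : ModularParametrizationData W (W.conductorNorm ℤ)) (H : HeegnerDatum (W.conductorNorm ℤ) (NumberField.discr K)) (ι : K →+* ℂ)
    (P : (W.baseChange K).toAffine.Point) (hP : WeierstrassCurve.Affine.Point.map ι.toRatAlgHom P = heegnerPointComplex Dt H)
    (Wd : WeierstrassCurve ℚ) [Wd.IsElliptic] [Wd.IsGloballyMinimal] (Cd : VariableChange ℚ)
    (hWd : Cd • W.quadraticTwist (NumberField.discr K : ℚ) = Wd) (hBd : BSDp Wd 2)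
    (m : ℕ) (hm : HasTwoDivisibilityUpToTorsion W K P m) : 2 + padicValInt 2 Dt.c ≤ m := by
  have hmod : hasEntireLFunction_rat := hasEntireLFunction_rat_of_exists_isNewformOf hnf
  have hrQ : W.mordellWeilRank = 1 := (mordellWeilRank_eq_one_of_analyticRank_eq_one_of_isGloballyMinimal hGZ hKo hnf hHL W hr).1
  have hadm : DoorAdmissible W (NumberField.discr K) := ANg16.doorAdmissible_of_descAdmissible W hDA
  have hHN : SatisfiesHeegnerHypothesis (W.conductorNorm ℤ) K := satisfiesHeegnerHypothesis_of_doorAdmissible W K hK hadm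
  obtain ⟨hfinW, hfinD, hiff⟩ :=
    bsdp_two_iff_doorLawFullC_at_of_rank hmod doorTwistTamagawaAtTwo W hT hc hr hrQ K hK (hGZ _ W K) (hKo _ W K) hadm hHN hLt Dt H ι P hP Wd Cd hWd hBd
  haveI := hfinW
  haveI := hfinD
  obtain ⟨m', hm', hlaw⟩ := hiff.mp hB
  obtain ⟨-, -, -, huniq⟩ := exists_unique_exponent_at_door hmod W hr K hK (hGZ _ W K) (hKo _ W K) hadm hLt Dt H ι P hP
  have hmm : m = m' := huniq m m' hm hm'
  subst hmm
  exact exponent_ge_two_add_padicVal_of_lawful_at_residue hnf W hr hrQ hres K hK (hGZ _ W K) (hKo _ W K) hDA hLt Dt H ι P hP Wd Cd hWd m hlaw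

end Summit.BirchSwinnertonDyer.BirchSwinnertonDyer.Theorems.RankOneAtTwoOneDoor

end
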